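import Summits.ValiantsHypothesis.ValiantsHypothesis.Theorems.LacunarySymmetroidMatrixDescartesDoorA26WallBubblingLexRowsPrescribed

/-!
# Wall bubbling for `DoorA26` — LEMMA L in MEMBER variables: the lexicographic row as LINEAR rows of the R3 LP

LINE / STUBS.  Crux `Theses.LacunarySymmetroid.DoorA26` (stmt-ValiantsHypothesis-19979; OPEN, typed, never asserted), line `Cruxes/DoorA26/Lines/wall_bubbling.lean`
(val-idea-15), obligation (M) `Stmt.stub_mixedWalls`; instrument memo `Lines/wall_bubbling_M-sieve.md` rev 10 §7.3 R3 («extend `Case` with fine-height variables for coarse-negative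
members (free reals) … impose the lexicographic rows») / §7.4 LEMMA L, last clause: «when the members' own fine heights exist, `h¹_m = Σ_ab m_ab h¹_ab` up to the common
normalisation, which is the LP row».  W1 #20/#22 (`…LexRows`, `…LexRowsPrescribed`) state LEMMA L with the relative fine heights of the top MONOMIALS as data (`φ_m`); the engine's
LP has variables per MEMBER.  This file is the bridge (def-free):

* `log_norm_eq_sup'` — for `y : ι → ℝ` with non-zero entries, `log ‖y‖ = max_j log|y_j|` (sup norm);
* `coarseNormalised_norm_tendsto` — if `(log|y^ν_i| − C·w₀^ν)/w₁^ν → X_i` for every `i` (one COMMON coarse height `C` = the top class), then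
  `(log‖y^ν‖ − C·w₀^ν)/w₁^ν → max_j X_j`; `relFineHeight_tendsto` — hence the relative fine height `(log|y^ν_i| − log‖y^ν‖)/w₁^ν → X_i − max_j X_j`;
* `lexRow_expansions` — LEMMA L (iii) in these coordinates: row + DOMINATION + eventual signs `s` ⇒ the maximum `max_j X_j` is attained at some `i` with `s_i = 1` AND at some `j`
  with `s_j = −1` (`lexRow_prescribed` with `A = univ`, `φ_i = X_i − max X`);
* `fineHeight_monomial` — two-term MEMBER expansions `(log|G^ν_a| − h0_a·w₀^ν)/w₁^ν → x_a` give, for a monomial `c·∏_a (G^ν_a)^{m_a}` of coarse height `⟨h0, m⟩`, the expansion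
  `(log|c·G^{ν,m}| − ⟨h0,m⟩·w₀^ν)/w₁^ν → ⟨x, m⟩` (heights add at the fine scale too; the constant `log|c|` is absorbed since `w₁ → ∞`);
* `lexRow_memberLinear` — **the R3 row in member variables**: for top monomials `m_i` (common coarse height `C = ⟨h0, m_i⟩`), coefficients `c_i ≠ 0`, member expansions `x`,
  row + DOMINATION + eventual signs ⇒ `∃ i j, (∀ k, ⟨x, m_k⟩ ≤ ⟨x, m_i⟩) ∧ ⟨x, m_j⟩ = ⟨x, m_i⟩ ∧ s_i = 1 ∧ s_j = −1` — the disjunction over pieces `(i, j)` of the LINEAR systems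
  `⟨x, m_i⟩ = ⟨x, m_j⟩ ≥ ⟨x, m_k⟩ (k ∈ T)` that `Case.decide` would impose, members dead at the fine scale being the engine's separate `−∞` case (#22's `A`).

Necessary conditions only; they kill nothing; nothing here bears on (M)/(W)/(R), on `DoorA26`, on `MatrixDescartes` (stmt-ValiantsHypothesis-18050) or on `VP ≠ VNP`; registers
unchanged.  Seat val-sym-door-p2 g12 (W1 #23), `--supports stmt-ValiantsHypothesis-19979 --as helper`. [folklore] finite maxima and limits. [this work] packaging for §7.3/§7.4.
-/

-- `Summit.ValiantsHypothesis.ValiantsHypothesis.…` repeats a component by the D-0017 layout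
-- (single-conjunct summit), which the `dupNamespace` linter flags; the name is mandated.
set_option linter.dupNamespace false

namespace Summit.ValiantsHypothesis.ValiantsHypothesis.Theorems.LacunarySymmetroidMatrixDescartes.WallBubbling.SecondOrder

open Finset Filter Topology
open scoped BigOperators

/-! ## §1 The sup norm in logarithmic coordinates -/

/-- The sup norm of `y : ι → ℝ` is the finite maximum of the moduli. [folklore] -/
theorem norm_eq_sup'_abs {ι : Type*} [Fintype ι] [Nonempty ι] (y : ι → ℝ) :
    ‖y‖ = Finset.univ.sup' Finset.univ_nonempty (fun j => |y j|) := by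
  refine le_antisymm ?_ ?_
  · refine (pi_norm_le_iff_of_nonneg ?_).mpr fun j => ?_
    · obtain ⟨j⟩ := ‹Nonempty ι›
      exact (abs_nonneg (y j)).trans (Finset.le_sup' (fun j => |y j|) (Finset.mem_univ j))
    · rw [Real.norm_eq_abs]
      exact Finset.le_sup' (fun j => |y j|) (Finset.mem_univ j)
  · refine Finset.sup'_le _ _ fun j _ => ?_
    have := norm_le_pi_norm y j
    rwa [Real.norm_eq_abs] at this

/-- **`log ‖y‖ = max_j log |y_j|`** for `y` with non-zero entries. [folklore] -/
theorem log_norm_eq_sup' {ι : Type*} [Fintype ι] [Nonempty ι] (y : ι → ℝ) (hy : ∀ j, y j ≠ 0) :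
    Real.log ‖y‖ = Finset.univ.sup' Finset.univ_nonempty (fun j => Real.log |y j|) := by
  rw [norm_eq_sup'_abs]
  obtain ⟨j₀, -, hj₀⟩ := Finset.exists_mem_eq_sup' Finset.univ_nonempty (fun j => |y j|)
  refine le_antisymm ?_ ?_
  · rw [hj₀]
    exact Finset.le_sup' (fun j => Real.log |y j|) (Finset.mem_univ j₀)
  · refine Finset.sup'_le _ _ fun j _ => ?_
    exact Real.log_le_log (abs_pos.mpr (hy j)) (Finset.le_sup' (fun j => |y j|) (Finset.mem_univ j))

/-! ## §2 Relative fine heights from coarse-normalised expansions -/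

/-- **The coarse-normalised log-norm converges to the maximum.**  If every top value has the expansion `(log|y^ν_i| − C·w₀^ν)/w₁^ν → X_i` (common coarse height `C`), the entries
are eventually non-zero and `w₁^ν > 0` eventually, then `(log‖y^ν‖ − C·w₀^ν)/w₁^ν → max_j X_j`. [folklore] -/
theorem coarseNormalised_norm_tendsto {ι : Type*} [Fintype ι] [Nonempty ι] (y : ℕ → ι → ℝ) (w₀ w₁ : ℕ → ℝ) (C : ℝ) (X : ι → ℝ)
    (hy : ∀ᶠ ν in atTop, ∀ j, y ν j ≠ 0) (hw₁ : ∀ᶠ ν in atTop, 0 < w₁ ν)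
    (hX : ∀ i, Tendsto (fun ν => (Real.log |y ν i| - C * w₀ ν) / w₁ ν) atTop (𝓝 (X i))) :
    Tendsto (fun ν => (Real.log ‖y ν‖ - C * w₀ ν) / w₁ ν) atTop
      (𝓝 (Finset.univ.sup' Finset.univ_nonempty X)) := by
  have hsup := Tendsto.finset_sup'_nhds_apply Finset.univ_nonempty (fun i (_ : i ∈ Finset.univ) => hX i)
  refine hsup.congr' ?_
  filter_upwards [hy, hw₁] with ν hν hw
  -- the affine increasing map `t ↦ (t − C w₀)/w₁` commutes with the finite maximum
  have hmono : Monotone (fun t : ℝ => (t - C * w₀ ν) / w₁ ν) := fun a b hab => by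
    exact div_le_div_of_nonneg_right (by linarith) hw.le
  rw [log_norm_eq_sup' (y ν) hν]
  exact (Finset.apply_sup'_eq_sup'_comp Finset.univ_nonempty (fun t : ℝ => (t - C * w₀ ν) / w₁ ν)
    (fun a b => hmono.map_max)).symm

/-- **Relative fine heights from expansions**: under the same hypotheses `(log|y^ν_i| − log‖y^ν‖)/w₁^ν → X_i − max_j X_j` for every `i`. [folklore] -/
theorem relFineHeight_tendsto {ι : Type*} [Fintype ι] [Nonempty ι] (y : ℕ → ι → ℝ) (w₀ w₁ : ℕ → ℝ) (C : ℝ) (X : ι → ℝ)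
    (hy : ∀ᶠ ν in atTop, ∀ j, y ν j ≠ 0) (hw₁ : ∀ᶠ ν in atTop, 0 < w₁ ν)
    (hX : ∀ i, Tendsto (fun ν => (Real.log |y ν i| - C * w₀ ν) / w₁ ν) atTop (𝓝 (X i))) (i : ι) :
    Tendsto (fun ν => (Real.log |y ν i| - Real.log ‖y ν‖) / w₁ ν) atTop
      (𝓝 (X i - Finset.univ.sup' Finset.univ_nonempty X)) := by
  have h := (hX i).sub (coarseNormalised_norm_tendsto y w₀ w₁ C X hy hw₁ hX)
  refine h.congr' ?_
  filter_upwards with ν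
  rw [← sub_div]
  ring_nf

/-- **LEMMA L (iii) in expansion coordinates.**  Row `Σ_i y^ν_i + r^ν = 0`, `y^ν ≠ 0`, DOMINATION `r^ν/‖y^ν‖ → 0`, eventual signs `s`, a fine scale `w₁ → ∞` and expansions
`(log|y^ν_i| − C·w₀^ν)/w₁^ν → X_i` for every top class ⇒ the maximum of `X` is attained at some `i` with `s_i = 1` and at some `j` with `s_j = −1`. [this work] -/
theorem lexRow_expansions {ι : Type*} [Fintype ι] [Nonempty ι] (y : ℕ → ι → ℝ) (r : ℕ → ℝ)
    (hsum : ∀ ν, ∑ i, y ν i + r ν = 0) (hy0 : ∀ ν, y ν ≠ 0) (hy : ∀ᶠ ν in atTop, ∀ j, y ν j ≠ 0)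
    (hr : Tendsto (fun ν => r ν / ‖y ν‖) atTop (𝓝 0))
    (s : ι → ℝ) (hs : ∀ i, ∀ᶠ ν in atTop, Real.sign (y ν i) = s i)
    (w₀ w₁ : ℕ → ℝ) (hw₁ : Tendsto w₁ atTop atTop) (C : ℝ) (X : ι → ℝ)
    (hX : ∀ i, Tendsto (fun ν => (Real.log |y ν i| - C * w₀ ν) / w₁ ν) atTop (𝓝 (X i))) :
    ∃ i j, (∀ k, X k ≤ X i) ∧ X j = X i ∧ s i = 1 ∧ s j = -1 := by
  have hfine := relFineHeight_tendsto y w₀ w₁ C X hy (hw₁.eventually_gt_atTop 0) hX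
  obtain ⟨i, -, j, -, hi, hj, hsi, hsj⟩ := lexRow_prescribed y r hsum hy0 hr s hs w₁ hw₁ Finset.univ
    (fun i => X i - Finset.univ.sup' Finset.univ_nonempty X) (fun i _ => hfine i) (fun i hi => absurd (Finset.mem_univ i) hi)
  have hXi : X i = Finset.univ.sup' Finset.univ_nonempty X := by linarith
  have hXj : X j = Finset.univ.sup' Finset.univ_nonempty X := by linarith
  refine ⟨i, j, fun k => ?_, by rw [hXi, hXj], hsi, hsj⟩
  rw [hXi]
  exact Finset.le_sup' X (Finset.mem_univ k)

/-! ## §3 Member variables -/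

/-- **Heights add at the fine scale**: two-term member expansions `(log|G^ν_a| − h0_a·w₀^ν)/w₁^ν → x_a` (`a ∈ s`, members non-zero), `w₁ → ∞`, `c ≠ 0` ⇒
`(log|c · ∏_{a∈s} (G^ν_a)^{m_a}| − ⟨h0, m⟩·w₀^ν)/w₁^ν → ⟨x, m⟩`. [folklore] -/
theorem fineHeight_monomial {α : Type*} (s : Finset α) (m : α → ℕ) (G : ℕ → α → ℝ) (w₀ w₁ : ℕ → ℝ) (h0 x : α → ℝ) (c : ℝ)
    (hc : c ≠ 0) (hG : ∀ ν, ∀ a ∈ s, G ν a ≠ 0) (hw₁ : Tendsto w₁ atTop atTop)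
    (hx : ∀ a ∈ s, Tendsto (fun ν => (Real.log |G ν a| - h0 a * w₀ ν) / w₁ ν) atTop (𝓝 (x a))) :
    Tendsto (fun ν => (Real.log |c * ∏ a ∈ s, G ν a ^ m a| - (∑ a ∈ s, (m a : ℝ) * h0 a) * w₀ ν) / w₁ ν) atTop
      (𝓝 (∑ a ∈ s, (m a : ℝ) * x a)) := by
  -- the constant `log|c|/w₁ → 0` plus the sum of the member expansions
  have hconst : Tendsto (fun ν => Real.log |c| / w₁ ν) atTop (𝓝 0) := tendsto_const_nhds.div_atTop hw₁
  have hsumx : Tendsto (fun ν => ∑ a ∈ s, (m a : ℝ) * ((Real.log |G ν a| - h0 a * w₀ ν) / w₁ ν)) atTop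
      (𝓝 (∑ a ∈ s, (m a : ℝ) * x a)) :=
    tendsto_finsetSum s fun a ha => (hx a ha).const_mul _
  have h := hconst.add hsumx
  rw [zero_add] at h
  refine h.congr fun ν => ?_
  rw [abs_mul, Real.log_mul (abs_ne_zero.mpr hc) (abs_ne_zero.mpr (Finset.prod_ne_zero_iff.mpr fun a ha => pow_ne_zero _ (hG ν a ha))),
    log_abs_monomial s m (G ν) (hG ν), Finset.sum_mul, add_sub_assoc, ← Finset.sum_sub_distrib, add_div, Finset.sum_div]
  congr 1
  refine Finset.sum_congr rfl fun a _ => ?_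
  ring

/-- **THE R3 ROW IN MEMBER VARIABLES.**  Members `G^ν_a` (`a ∈ s`, non-zero) with two-term expansions `x_a` at the scales `w₀` (coarse) / `w₁ → ∞` (fine); top monomials `m_i` with
coefficients `c_i ≠ 0`, ONE common coarse height `C = ⟨h0, m_i⟩`; values `y^ν_i = c_i·∏_a (G^ν_a)^{m_i a}` (`hydef`); row `Σ_i y^ν_i + r^ν = 0`; DOMINATION `r^ν/‖y^ν‖ → 0`; eventual signs
`s`.  Then the maximum of the linear forms `⟨x, m_k⟩` over the top class is attained at a monomial with `s = 1` and at one with `s = −1`: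
`∃ i j, (∀ k, ⟨x,m_k⟩ ≤ ⟨x,m_i⟩) ∧ ⟨x,m_j⟩ = ⟨x,m_i⟩ ∧ s_i = 1 ∧ s_j = −1`.  USE: `ι` indexes ONLY the top coarse class `T` (`hC`; `[Nonempty ι]`) — every lower
monomial goes into the rest `r`, exactly as the LP uses the row (crit-5 g3 2026-08-28T21:44Z). [this work] -/
theorem lexRow_memberLinear {α ι : Type*} [Fintype ι] [Nonempty ι] (s : Finset α) (G : ℕ → α → ℝ) (hG : ∀ ν, ∀ a ∈ s, G ν a ≠ 0)
    (w₀ w₁ : ℕ → ℝ) (hw₁ : Tendsto w₁ atTop atTop) (h0 x : α → ℝ)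
    (hx : ∀ a ∈ s, Tendsto (fun ν => (Real.log |G ν a| - h0 a * w₀ ν) / w₁ ν) atTop (𝓝 (x a)))
    (m : ι → α → ℕ) (c : ι → ℝ) (hc : ∀ i, c i ≠ 0) (C : ℝ) (hC : ∀ i, ∑ a ∈ s, (m i a : ℝ) * h0 a = C)
    (y : ℕ → ι → ℝ) (hydef : ∀ ν i, y ν i = c i * ∏ a ∈ s, G ν a ^ m i a)
    (r : ℕ → ℝ) (hsum : ∀ ν, ∑ i, y ν i + r ν = 0) (hdom : Tendsto (fun ν => r ν / ‖y ν‖) atTop (𝓝 0))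
    (sg : ι → ℝ) (hs : ∀ i, ∀ᶠ ν in atTop, Real.sign (y ν i) = sg i) :
    ∃ i j, (∀ k, ∑ a ∈ s, (m k a : ℝ) * x a ≤ ∑ a ∈ s, (m i a : ℝ) * x a) ∧
      ∑ a ∈ s, (m j a : ℝ) * x a = ∑ a ∈ s, (m i a : ℝ) * x a ∧ sg i = 1 ∧ sg j = -1 := by
  have hyne : ∀ ν j, y ν j ≠ 0 := fun ν j => by
    rw [hydef]
    exact mul_ne_zero (hc j) (Finset.prod_ne_zero_iff.mpr fun a ha => pow_ne_zero _ (hG ν a ha))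
  have hy0 : ∀ ν, y ν ≠ 0 := fun ν h => by
    obtain ⟨j⟩ := ‹Nonempty ι›
    exact hyne ν j (by rw [h]; rfl)
  have hX : ∀ i, Tendsto (fun ν => (Real.log |y ν i| - C * w₀ ν) / w₁ ν) atTop (𝓝 (∑ a ∈ s, (m i a : ℝ) * x a)) := by
    intro i
    have h := fineHeight_monomial s (m i) G w₀ w₁ h0 x (c i) (hc i) hG hw₁ hx
    rw [hC i] at h
    refine h.congr fun ν => ?_
    rw [hydef]
  exact lexRow_expansions y r hsum hy0 (Eventually.of_forall hyne) hdom sg hs w₀ w₁ hw₁ C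
    (fun i => ∑ a ∈ s, (m i a : ℝ) * x a) hX

end Summit.ValiantsHypothesis.ValiantsHypothesis.Theorems.LacunarySymmetroidMatrixDescartes.WallBubbling.SecondOrder
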